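import Mathlib
import Summits.Ventures.PercRepro2.Defs
import Summits.Ventures.PercRepro2.Independence
import Summits.Ventures.PercRepro2.Harris
import Summits.Ventures.PercRepro2.Graph
import Summits.Ventures.PercRepro2.Exploration
import Summits.Ventures.PercRepro2.Events
import Summits.Ventures.PercRepro2.GateCylinder
import Summits.Ventures.PercRepro2.CDRequired
import Summits.Ventures.PercRepro2.CutVertexDefs
import Summits.Ventures.PercRepro2.CDCutVertex
import Summits.Ventures.PercRepro2.CDCycle
import Summits.Ventures.PercRepro2.CDCutAC
import Summits.Ventures.PercRepro2.CDFanPockets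

/-!
# Pockets at both ends: the fan (or a `Q`-cylinder) as the block of `a₂` and `o`, with `a₁` and `a₃`
in arbitrary graphs hanging at its two ends (blind cell PercRepro2, mine-a g36; MINE-A.md §91.11)

Three more composites of the (AC) transfers of `CDCutAC`:

* `cd_of_cylinder_Q_far` — `a₃` beyond a cut vertex `v` such that `{a₁ ↔ v}` is a cylinder under `Q`
  (`CDCycle.required_anticorr_of_cylinder_Q`: a unique `a₁–v` route of `G − a₂`, e.g. a path of
  bridges, or one arc of a cycle through `a₂`); the far side arbitrary.
* `cd_of_fan_root` — `a₁` beyond a cut vertex at the root `x 0` of a fan whose edges carry the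
  connection `x 0 ↔ hub` (`CDFanPockets.ac_of_fan_carried`), `a₃` the hub, `a₂` and `o` beyond the
  root cut (on the fan or in its pockets); the near side arbitrary.
* `cd_of_fan_pockets_root` — both: `a₁` in an arbitrary graph hanging at `x 0`, `a₃` in an arbitrary
  graph hanging at the hub, `a₂` and `o` on the fan or in the pockets at the path vertices.  The
  block-cut tree of the placement is a fan with arbitrary blocks at all its vertices and the four marks
  anywhere compatible with it — every up-set, every admissible weight vector.

The carrying hypothesis (`hcarry`) is discharged by `CDFanPockets.conn_restrict_of_cuts` from the family
of cuts of the pockets (the root cut read from the fan's side, `h.symm`, and the hub cut included).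
No definition; one seat.
-/

namespace Summit.Ventures.PercRepro2

namespace CDFanBlocks

section Main

variable {V : Type*} {E : Type*} [Fintype E] [DecidableEq E] [Fintype V] [DecidableEq V]
  {R : Type*} [Field R] [LinearOrder R] [IsStrictOrderedRing R]

variable {ends : E → Sym2 V} {VA VB : Set V} {EA EB : Set E} [DecidablePred (· ∈ EA)]
  [DecidablePred (· ∈ EB)]

/-- **Row 2′CD with `a₃` beyond a cut vertex `v` of a `Q`-cylinder placement `(a₁, a₂, v)`**: under
`Q = {a₁ ↮ a₂}` the event `{a₁ ↔ v}` is the cylinder of an edge set `B`; the far side is arbitrary. -/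
theorem cd_of_cylinder_Q_far (p : E → R) (hp : IsProbVec p) {v : V}
    (h : CutV.IsCut ends v VA VB EA EB) {a₁ a₂ a₃ o : V} (ha₁ : a₁ ∈ VA ∪ {v})
    (ha₂ : a₂ ∈ VA ∪ {v}) (ho : o ∈ VA ∪ {v}) (ha₃ : a₃ ∈ VB) {𝓔 : Set (Set V)}
    (h𝓔 : IsUpperSet 𝓔) {B : Finset E}
    (hB : (connEvent ends a₁ a₂)ᶜ ∩ connEvent ends a₁ v =
      (connEvent ends a₁ a₂)ᶜ ∩ GateCylinder.cylinder B) :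
    let Q := (connEvent ends a₁ a₂)ᶜ
    let U := clusterInEvent ends a₁ 𝓔
    let e := connEvent ends a₁ a₃
    let f := connEvent ends a₂ o
    let N := (connEvent ends a₁ a₃)ᶜ ∩ (connEvent ends a₂ a₃)ᶜ
    let oU := connEvent ends a₁ o ∪ connEvent ends a₂ o
    prob p (Q ∩ N) * (prob p Q * prob p (Q ∩ U ∩ e ∩ f) - prob p (Q ∩ U) * prob p (Q ∩ e ∩ f)) ≤
      prob p (Q ∩ N ∩ oU) * (prob p Q * prob p (Q ∩ U ∩ e) - prob p (Q ∩ U) * prob p (Q ∩ e)) :=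
  CDCutAC.cd_of_cut_far p hp h ha₁ ha₂ ho ha₃ h𝓔 fun _ h𝓤 =>
    CDCycle.required_anticorr_of_cylinder_Q _ (CDCutVertex.isProbVec_zeroOff hp EA) ends a₁ a₂ v o
      h𝓤 hB

/-- **Row 2′CD with `a₁` beyond a cut vertex at the root `x 0` of a fan** whose edges carry the
connection `x 0 ↔ v`, `a₃ = v` the hub, `a₂` and `o` beyond the root cut; the near side (the graph
hanging at `x 0` that carries `a₁`) is arbitrary. -/
theorem cd_of_fan_root (p : E → R) (hp : IsProbVec p) {v : V} (m : ℕ) (x : ℕ → V) (r c : ℕ → E)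
    (hr : ∀ j, j < m → ends (r j) = s(x j, x (j + 1))) (hc : ∀ i, i ≤ m → ends (c i) = s(x i, v))
    (hx : ∀ i j, i ≤ m → j ≤ m → x i = x j → i = j) (hv : ∀ i, i ≤ m → x i ≠ v)
    (h : CutV.IsCut ends (x 0) VA VB EA EB) {a₁ a₂ o : V} (ha₁ : a₁ ∈ VA ∪ {x 0})
    (ha₂ : a₂ ∈ VB) (ho : o ∈ VB) (hvB : v ∈ VB)
    (EF : Set E) [DecidablePred (· ∈ EF)]
    (hEF : ∀ e : E, e ∈ EF → (∃ j, j < m ∧ e = r j) ∨ (∃ i, i ≤ m ∧ e = c i))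
    (hcarry : ∀ ω : Config E, Conn ends ω (x 0) v → Conn ends (restrict EF ω) (x 0) v)
    {𝓔 : Set (Set V)} (h𝓔 : IsUpperSet 𝓔) :
    let Q := (connEvent ends a₁ a₂)ᶜ
    let U := clusterInEvent ends a₁ 𝓔
    let e := connEvent ends a₁ v
    let f := connEvent ends a₂ o
    let N := (connEvent ends a₁ v)ᶜ ∩ (connEvent ends a₂ v)ᶜ
    let oU := connEvent ends a₁ o ∪ connEvent ends a₂ o
    prob p (Q ∩ N) * (prob p Q * prob p (Q ∩ U ∩ e ∩ f) - prob p (Q ∩ U) * prob p (Q ∩ e ∩ f)) ≤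
      prob p (Q ∩ N ∩ oU) * (prob p Q * prob p (Q ∩ U ∩ e) - prob p (Q ∩ U) * prob p (Q ∩ e)) :=
  CDCutAC.cd_of_cut_root p hp h ha₁ ha₂ ho (Or.inl hvB) h𝓔 fun _ h𝓤 =>
    CDFanPockets.ac_of_fan_carried _ (CDCutVertex.isProbVec_zeroOff hp EB) a₂ o m x r c hr hc hx hv
      EF hEF hcarry h𝓤

/-- **Row 2′CD with `a₁` in an arbitrary graph hanging at the root `x 0` of a fan and `a₃` in an arbitrary
graph hanging at its hub `v`**, `a₂` and `o` on the fan or in the pockets at the path vertices (beyond the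
root cut `h`, on the near side of the hub cut `h'`), the fan edges carrying `x 0 ↔ v`: the row holds at
`(a₁, a₂, a₃, o)` for every up-set and every admissible weight vector. -/
theorem cd_of_fan_pockets_root (p : E → R) (hp : IsProbVec p) {v : V} (m : ℕ) (x : ℕ → V)
    (r c : ℕ → E) (hr : ∀ j, j < m → ends (r j) = s(x j, x (j + 1)))
    (hc : ∀ i, i ≤ m → ends (c i) = s(x i, v)) (hx : ∀ i j, i ≤ m → j ≤ m → x i = x j → i = j)
    (hv : ∀ i, i ≤ m → x i ≠ v) (h : CutV.IsCut ends (x 0) VA VB EA EB) {VA' VB' : Set V}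
    {EA' EB' : Set E} [DecidablePred (· ∈ EA')] [DecidablePred (· ∈ EB')]
    (h' : CutV.IsCut ends v VA' VB' EA' EB') {a₁ a₂ a₃ o : V} (ha₁ : a₁ ∈ VA ∪ {x 0})
    (ha₂ : a₂ ∈ VB) (ho : o ∈ VB) (ha₃ : a₃ ∈ VB) (hx0' : x 0 ∈ VA' ∪ {v}) (ha₂' : a₂ ∈ VA' ∪ {v})
    (ho' : o ∈ VA' ∪ {v}) (ha₃' : a₃ ∈ VB') (EF : Set E) [DecidablePred (· ∈ EF)]
    (hEF : ∀ e : E, e ∈ EF → (∃ j, j < m ∧ e = r j) ∨ (∃ i, i ≤ m ∧ e = c i))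
    (hcarry : ∀ ω : Config E, Conn ends ω (x 0) v → Conn ends (restrict EF ω) (x 0) v)
    {𝓔 : Set (Set V)} (h𝓔 : IsUpperSet 𝓔) :
    let Q := (connEvent ends a₁ a₂)ᶜ
    let U := clusterInEvent ends a₁ 𝓔
    let e := connEvent ends a₁ a₃
    let f := connEvent ends a₂ o
    let N := (connEvent ends a₁ a₃)ᶜ ∩ (connEvent ends a₂ a₃)ᶜ
    let oU := connEvent ends a₁ o ∪ connEvent ends a₂ o
    prob p (Q ∩ N) * (prob p Q * prob p (Q ∩ U ∩ e ∩ f) - prob p (Q ∩ U) * prob p (Q ∩ e ∩ f)) ≤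
      prob p (Q ∩ N ∩ oU) * (prob p Q * prob p (Q ∩ U ∩ e) - prob p (Q ∩ U) * prob p (Q ∩ e)) :=
  CDCutAC.cd_of_cut_root p hp h ha₁ ha₂ ho (Or.inl ha₃) h𝓔 fun _ h𝓤 =>
    CDCutAC.required_anticorr_of_cut_far _ (CDCutVertex.isProbVec_zeroOff hp EB) h' hx0' ha₂' ho'
      ha₃' h𝓤 fun _ h𝓤' =>
        CDFanPockets.ac_of_fan_carried _
          (CDCutVertex.isProbVec_zeroOff (CDCutVertex.isProbVec_zeroOff hp EB) EA') a₂ o m x r c hr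
          hc hx hv EF hEF hcarry h𝓤'

end Main

end CDFanBlocks

end Summit.Ventures.PercRepro2
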